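import Summits.Ventures.PercRepro.Night2LocalD2R14SixZeroK

/-!
# PercRepro — the six-element columns of R1₄ without a far preimage, part L: the cell `κ = 0` (night-2, gen 16)

Without a far preimage and without a coloop of `S` besides `y` (`|S| = 6`): no covering preimage, at most ten pair
preimages, the pair part plus the `p₅`-share of the spread is at most `t·(2/25) + (p − t)·(2/75)`, and the rest of the
spread is at most `(1/5)/(|G ∖ S| + 1)`.  With `t ≤ 5` pair preimages of `|G ∖ cl B| = 3` — automatic from
`mul_card_four_le` once `|G ∖ S| ≥ 4` — the column is `≤ 59/60` (proofs/NIGHT-2-k1.md §7.3–7.4):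

* **`sum_r14W_col_le_of_card_six_of_noColoop`** (hypothesis `t ≤ 5`);
* **`sum_r14W_col_le_of_card_six_of_noColoop_of_four_le`** (`4 ≤ |G ∖ S|`, unconditional);
* **`shadowHall_six_four_of_six_columns_noColoop_three`**: THE (6,4) SHADOW ROW FOR EVERY FINITE MATROID modulo the
  six-element columns without a far preimage, without a coloop of `S` besides `y` and with `|G ∖ S| = 3` — the single
  remaining cell, whose paper proof is §7.4 (`t = 6` at `|G ∖ S| = 3` needs three pairwise disjoint pairs in five points).
-/

namespace PercRepro.Shadow

open Finset PerFlat ThmH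

variable {α : Type*} [DecidableEq α] {M : Matroid α} [M.Finite]

open scoped Classical in
/-- **The column of R1₄ at a six-element shadow set without a far preimage and without a coloop of `S` besides `y`,
given at most five pair preimages of `|G ∖ cl B| = 3`**: at most `1` (`≤ 59/60`). -/
theorem sum_r14W_col_le_of_card_six_of_noColoop {G : Finset α} (hG : G ∈ flatsQ M (4 + 1))
    (hd : (gr M \ G).card = 2) {y : α} (hyG : y ∈ G) (hyc : y ∉ clF M (G.erase y))
    (hP : ∀ z ∈ G.erase y, 4 ≤ rkN M ((G.erase y).erase z)) {S : Finset α}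
    (hS : S ∈ shadowAt M (4 + 2) 4 (Uq M (4 + 2) 4) G) (h6 : S.card = 6) (hf : opFarPre M G S = ∅)
    (hno : ∀ z ∈ S, z ≠ y → z ∈ clF M (S.erase z))
    (ht5 : 3 ≤ (G \ S).card → ((pairPre M 4 G S).filter (fun B => (G \ clF M B).card = 3)).card ≤ 5) :
    ∑ B ∈ membersIn M (Uq M (4 + 2) 4) G, r14W M G B S ≤ 1 := by
  have hparts := sum_r14W_col_le_parts (M := M) G S
  rw [r14KeepPre_eq_empty (by omega), Finset.sum_empty, r14PairPre_eq_pairPre,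
    r14CovPre_eq_empty_of_noColoop hG hyG hyc hno, Finset.sum_empty] at hparts
  set q : ℚ := ((G \ S).card : ℚ) with hqdef
  have hq0 : (0 : ℚ) ≤ q := Nat.cast_nonneg _
  have hq1 : (0 : ℚ) < q + 1 := by positivity
  set p := (pairPre M 4 G S).card with hpdef
  set t := ((pairPre M 4 G S).filter (fun B => (G \ clF M B).card = 3)).card with htdef
  set p₅ := ((pairPre M 4 G S).filter (fun B => 5 ≤ (G \ clF M B).card)).card with hp₅def
  have hp10 : p ≤ 10 := card_pairPre_le_ten hG hyG hyc hS h6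
  have htp : t ≤ p := Finset.card_le_card (Finset.filter_subset _ _)
  have hspread := r14Spread_le_of_noColoop hG hyG hyc hP hS h6 hno
  rw [← hp₅def, ← hqdef] at hspread
  have hc' : (4 / 175 : ℚ) / (q + 1) ≤ 2 / 75 := by
    rw [div_le_iff₀ hq1]
    nlinarith
  have hpair := sum_r14Pair_add_le (M := M) (G := G) (S := S) hf hc'
  rw [← hp₅def, ← htdef, ← hpdef] at hpair
  have hι := card_r14IdPre_le_one hG hyG hyc hP hS
  have hsp : r14Spread M G S ≤ (1 / 5) / (q + 1) + (4 / 175) / (q + 1) * (p₅ : ℚ) := by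
    have : (1 / 5 + (4 / 175) * (p₅ : ℚ)) / (q + 1) = (1 / 5) / (q + 1) + (4 / 175) / (q + 1) * (p₅ : ℚ) := by
      field_simp
    linarith
  have hpq : (p : ℚ) ≤ 10 := by exact_mod_cast hp10
  have htpq : (t : ℚ) ≤ (p : ℚ) := by exact_mod_cast htp
  have ht0 : (0 : ℚ) ≤ (t : ℚ) := Nat.cast_nonneg _
  rcases Nat.eq_zero_or_pos (r14IdPre M G S).card with h0 | hpos
  · rw [h0] at hparts
    simp only [Nat.cast_zero, zero_mul, zero_add] at hparts
    have h15 : (1 / 5 : ℚ) / (q + 1) ≤ 1 / 5 := by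
      rw [div_le_iff₀ hq1]
      nlinarith
    have hpairs : ∑ B ∈ pairPre M 4 G S, r14Pair M G B + (4 / 175) / (q + 1) * (p₅ : ℚ) ≤ 4 / 5 := by
      have : (t : ℚ) * (2 / 25) + ((p : ℚ) - (t : ℚ)) * (2 / 75) ≤ 4 / 5 := by nlinarith
      linarith
    linarith
  · obtain ⟨B, hB⟩ := Finset.card_pos.1 hpos
    have hq3 := three_le_card_sdiff_of_idPre hG hd hyG hyc hP hS hB
    have hq3' : (3 : ℚ) ≤ q := by rw [hqdef]; exact_mod_cast hq3
    have ht5' : (t : ℚ) ≤ 5 := by exact_mod_cast ht5 hq3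
    have h15 : (1 / 5 : ℚ) / (q + 1) ≤ 1 / 20 := by
      rw [div_le_iff₀ hq1]
      nlinarith
    have hpairs : ∑ B ∈ pairPre M 4 G S, r14Pair M G B + (4 / 175) / (q + 1) * (p₅ : ℚ) ≤ 8 / 15 := by
      have : (t : ℚ) * (2 / 25) + ((p : ℚ) - (t : ℚ)) * (2 / 75) ≤ 8 / 15 := by nlinarith
      linarith
    have hι' : ((r14IdPre M G S).card : ℚ) ≤ 1 := by exact_mod_cast hι
    nlinarith

open scoped Classical in
/-- With `|G ∖ S| ≥ 4` there are at most five pair preimages of `|G ∖ cl B| = 3` (from `t(q−1) ≤ 4q`). -/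
theorem card_three_le_five_of_four_le {G : Finset α} (hG : G ∈ flatsQ M (4 + 1))
    (hsimple : ∀ e ∈ gr M, ∀ f ∈ gr M, e ≠ f → rkN M {e, f} = 2) {y : α} (hyG : y ∈ G)
    (hyc : y ∉ clF M (G.erase y)) {S : Finset α} (hS : S ∈ shadowAt M (4 + 2) 4 (Uq M (4 + 2) 4) G)
    (h6 : S.card = 6) (hq : 4 ≤ (G \ S).card) :
    ((pairPre M 4 G S).filter (fun B => (G \ clF M B).card = 3)).card ≤ 5 := by
  have h := mul_card_four_le hG hsimple hyG hyc hS h6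
  by_contra hcon
  push Not at hcon
  have h1 : 6 * ((G \ S).card - 1) ≤ ((pairPre M 4 G S).filter (fun B => (G \ clF M B).card = 3)).card *
      ((G \ S).card - 1) := Nat.mul_le_mul_right _ (by omega)
  have h2 : 6 * ((G \ S).card - 1) ≤ 4 * (G \ S).card := le_trans h1 h
  omega

open scoped Classical in
/-- The cell `κ = 0` with `|G ∖ S| ≥ 4`: the column is at most `1`. -/
theorem sum_r14W_col_le_of_card_six_of_noColoop_of_four_le {G : Finset α} (hG : G ∈ flatsQ M (4 + 1))
    (hd : (gr M \ G).card = 2) (hsimple : ∀ e ∈ gr M, ∀ f ∈ gr M, e ≠ f → rkN M {e, f} = 2) {y : α}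
    (hyG : y ∈ G) (hyc : y ∉ clF M (G.erase y)) (hP : ∀ z ∈ G.erase y, 4 ≤ rkN M ((G.erase y).erase z))
    {S : Finset α} (hS : S ∈ shadowAt M (4 + 2) 4 (Uq M (4 + 2) 4) G) (h6 : S.card = 6)
    (hf : opFarPre M G S = ∅) (hno : ∀ z ∈ S, z ≠ y → z ∈ clF M (S.erase z)) (hq : 4 ≤ (G \ S).card) :
    ∑ B ∈ membersIn M (Uq M (4 + 2) 4) G, r14W M G B S ≤ 1 :=
  sum_r14W_col_le_of_card_six_of_noColoop hG hd hyG hyc hP hS h6 hf hno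
    (fun _ => card_three_le_five_of_four_le hG hsimple hyG hyc hS h6 hq)

open scoped Classical in
/-- (LI_G) in Case A modulo the six-element columns without a far preimage, without a coloop, with `|G ∖ S| = 3`. -/
theorem localShadowHall_caseA_of_six_columns_noColoop_three {G : Finset α} (hG : G ∈ flatsQ M (4 + 1))
    (hd : (gr M \ G).card = 2) (hsimple : ∀ e ∈ gr M, ∀ f ∈ gr M, e ≠ f → rkN M {e, f} = 2)
    (hk : kColoops M G = 1) {y : α} (hyG : y ∈ G) (hyc : y ∉ clF M (G.erase y))
    (hcol6 : ∀ S ∈ shadowAt M (4 + 2) 4 (Uq M (4 + 2) 4) G, S.card = 6 → opFarPre M G S = ∅ →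
      (∀ z ∈ S, z ≠ y → z ∈ clF M (S.erase z)) → (G \ S).card = 3 →
      ∑ B ∈ membersIn M (Uq M (4 + 2) 4) G, r14W M G B S ≤ 1) :
    LocalShadowHall M 4 G := by
  have hP := four_le_rkN_erase_erase_of_kColoops_eq_one hG hk hyG hyc
  apply localShadowHall_caseA_of_six_columns_noColoop hG hd hsimple hk hyG hyc
  intro S hS h6 hf hno
  rcases Nat.lt_or_ge (G \ S).card 4 with hq | hq
  · rcases Nat.lt_or_ge (G \ S).card 3 with hq' | hq'
    · -- `|G ∖ S| ≤ 2`: no identity preimage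
      exact sum_r14W_col_le_of_card_six_of_noColoop hG hd hyG hyc hP hS h6 hf hno (fun h => absurd h (by omega))
    · exact hcol6 S hS h6 hf hno (by omega)
  · exact sum_r14W_col_le_of_card_six_of_noColoop_of_four_le hG hd hsimple hyG hyc hP hS h6 hf hno hq

section SixFour

variable {α' : Type} [DecidableEq α']

/-- **THE `(6, 4)` SHADOW ROW FOR EVERY FINITE MATROID, MODULO THE SIX-ELEMENT COLUMNS OF R1₄ WITHOUT A FAR
PREIMAGE, WITHOUT A COLOOP OF `S` BESIDES `y`, AND WITH `|G ∖ S| = 3`** (the single remaining cell; its paper proof is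
proofs/NIGHT-2-k1.md §7.4: at most five pair preimages of `|G ∖ cl B| = 3`). -/
theorem shadowHall_six_four_of_six_columns_noColoop_three
    (hsix : ∀ (N : Matroid α') [N.Finite], (∀ e ∈ gr N, ∀ f ∈ gr N, e ≠ f → rkN N {e, f} = 2) →
      (∀ e ∈ gr N, N.Indep {e}) → N.eRank = ((6 : ℕ) : ℕ∞) →
      ∀ G ∈ flatsQ N (4 + 1), (gr N \ G).card = 2 → kColoops N G = 1 →
      ∀ y ∈ G, y ∉ clF N (G.erase y) → 6 ≤ rkN N ((gr N).erase y) →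
      ∀ S ∈ shadowAt N (4 + 2) 4 (Uq N (4 + 2) 4) G, S.card = 6 → opFarPre N G S = ∅ →
      (∀ z ∈ S, z ≠ y → z ∈ clF N (S.erase z)) → (G \ S).card = 3 →
        ∑ B ∈ membersIn N (Uq N (4 + 2) 4) G, r14W N G B S ≤ 1)
    (M : Matroid α') [M.Finite] : ShadowHall M 6 4 (phiK 6 4) := by
  apply shadowHall_six_four_of_local_caseA
  intro N _ hs hl hr G hG hd hk y hyG hyc hr6
  exact localShadowHall_caseA_of_six_columns_noColoop_three hG hd hs hk hyG hyc
    (hsix N hs hl hr G hG hd hk y hyG hyc hr6)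

end SixFour

end PercRepro.Shadow
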